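import Summits.BirchSwinnertonDyer.BirchSwinnertonDyer.Theorems.KolyvaginRankRigidityAtTwoSwapFromPiecesPrelims
import Summits.BirchSwinnertonDyer.BirchSwinnertonDyer.Theorems.KolyvaginRankRigidityAtTwoOffHabitatIrredWindowPrime
import Summits.BirchSwinnertonDyer.BirchSwinnertonDyer.Theorems.KolyvaginRankRigidityAtTwoOffHabitatIrredLocalTrivialAtConductor
import Summits.BirchSwinnertonDyer.BirchSwinnertonDyer.Theorems.Rank1ResidualJetCompatibleDataTriple
import Literature.NumberTheory.EllipticCurves.HeegnerGeomCoherentDataOfFrameProofs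
import HarnessLib

/-!
# Route `KolyvaginRankRigidityAtTwo`, residual crux R_irr `OffHabitatIrredNonSurjTwoConverse`
# (stmt-BirchSwinnertonDyer-27123, LINE 8∞ `kolyvagin_depth_split_inf_irr`): the LOSSY prime swap at `2`, CORE,
# OFF THE HABITAT — re-threading of `primeSwapAtTwoLossy_core_frob_nine` (`…SwapFromPiecesCoreFrobNine`)
# through the off-habitat suppliers (width seat krr2-p2 g10; helper, `--supports` 27123)

`primeSwapAtTwoLossy_core_offHabitat`: VERBATIM the habitat core `primeSwapAtTwoLossy_core_frob_nine` (Kolyvagin's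
prime swap [1] Prop. 8 = McCallum Prop. 5.2 = W. Zhang L8.4 step at `p = 2`, conductor currency `n ↦ n / a · ℓ`,
Frobenius-threaded P7a, P5 asked only for `M ≥ 9`) with the habitat binder `(∀ m, ρ_{E,2^m} onto)` replaced by
R_irr's frame `E(ℚ)[2] = 0` (`htorQ`) plus the uniform inflation defect `k` of the `2`-division tower (`hSah`,
supplied off habitat by `inflationDefect_of_serre`, p648454), and the four image-consuming calls re-threaded:
* T3 `stub_conjSign` ↦ `conjSign_offHabitat` (p651821);
* pair Čebotarev `exists_kolyvaginPrime_notMem_pair_frob` (order-free, defect `2`) ↦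
  `exists_kolyvaginPrime_notMem_pair_orderFree_of_inflationDefect` (p655785; order-free, defect `k + 1`, with
  `E[2]` simple from `simple_two_of_torsionBy_eq_bot`, p647473);
* Q2 `KolyvaginRelationAtTwo` by name ↦ `GenusExact.kolyvaginRelationAtTwo_offHabitat_of_frobeniusCongruence h37`
  (p650518, modulo Gross 1991 Prop. 3.7 (2)) and its conductor cast `kolyvaginRelationAtTwo_cast_offHabitat` (T1 file, p656912+).
Everything else (P4, P5, P6, P7a/b, P8, Poitou–Tate families, Weil data, P1 data triples, T2, S2) is image-free and
enters exactly as on the habitat. Exponents with defect `k + 1` per class: `c₀ = 2 (c₁ + 2k + t + 12)`, `c₂ = c₁ + 2k + 4`.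
HONEST FRAMING: a composition modulo the hypotheses listed and the named print fact `prop37_2_frobeniusCongruence`;
helper for the re-threading of V2irr / U2irr; nothing here proves S1L off habitat unconditionally, R_irr, or BSD.
[cite: Kolyvagin1991MathAnn, §2 Thm. 2.2, p. 257] [cite: McCallumLMS1991, §5 Prop. 5.2, Lemma 5.3]
[cite: WZhang2014, Lemma 8.2, Lemma 8.4] [cite: GrossLMS1991, Prop. 3.7 (2)] -/

set_option autoImplicit false
set_option linter.dupNamespace false

noncomputable section

open scoped Classical Pointwise
open Function NumberField IsDedekindDomain WeierstrassCurve Field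
open Literature.NumberTheory.EllipticCurves Literature.NumberTheory.GaloisRepresentations
open Literature.NumberTheory.EllipticCurves.Jetchev2008 Literature.NumberTheory.EllipticCurves.ModularForms
open Literature.NumberTheory.GaloisCohomology
open Literature.NumberTheory.GaloisRepresentations.DiscreteGaloisModule (localTatePairingZMod tateDual SelmerStructure)
open Summit.BirchSwinnertonDyer.Rank1Residual.JET.SelmerVocabulary
open Summit.BirchSwinnertonDyer.Rank1Residual.JET.GlobalDuality
open Summit.BirchSwinnertonDyer.BirchSwinnertonDyer.Theses.KolyvaginRankRigidityAtTwo
open Literature.NumberTheory.EllipticCurves.GrossLMS1991 (prop37_2_frobeniusCongruence)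

namespace Summit.BirchSwinnertonDyer.BirchSwinnertonDyer.Theorems.KolyvaginLowerBoundAtTwo
section Frame

variable {K : Type} [Field K] [NumberField K] (W : WeierstrassCurve ℚ) [W.IsElliptic]
  [W.IsGloballyMinimal] [(W.baseChange K).IsElliptic] [NeZero (W.conductorNorm ℤ)]
  [∀ M : ℕ, NeZero (2 ^ M)] [∀ M : ℕ, Finite (geomTorsion (W.baseChange K) ((2 ^ M : ℕ) : ℤ))]
  (τ : K ≃ₐ[ℚ] K)
  (Dt : ModularParametrizationData W (W.conductorNorm ℤ)) (β : ℤ) (ι : K →+* ℂ)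
  (e : ∀ M : ℕ, geomTorsion (W.baseChange K) ((2 ^ M : ℕ) : ℤ) →
    geomTorsion (W.baseChange K) ((2 ^ M : ℕ) : ℤ) → AlgebraicClosure K)
  (hμ : ∀ M S T, e M S T ^ (2 ^ M) = 1)
  (hadd₁ : ∀ M S₁ S₂ T, e M (S₁ + S₂) T = e M S₁ T * e M S₂ T)
  (hadd₂ : ∀ M S T₁ T₂, e M S (T₁ + T₂) = e M S T₁ * e M S T₂)
  (hgal : ∀ M (g : absoluteGaloisGroup K) (S T : geomTorsion (W.baseChange K) ((2 ^ M : ℕ) : ℤ)),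
    g • e M S T = e M (g • S) (g • T))
  (halt : ∀ M T, e M T T = 1) (hnondeg : ∀ M T, (∀ S, e M S T = 1) → T = 0)
  (inv : ∀ M : ℕ, LocalInvariants K (2 ^ M))
  (𝒯 : ∀ M : ℕ, SelmerStructure ((W.baseChange K).torsionGaloisModule ((2 ^ M : ℕ) : ℤ)))
  -- R_irr's frame (off the surjective habitat: `E(ℚ)[2] = 0`)
  (hCM : ¬ W.HasCM) (hred : Rank1Residual.GoodOrd W 2 ∨ Rank1Residual.Mult W 2)
  (htorQ : AddSubgroup.torsionBy W.toAffine.Point (2 : ℤ) = ⊥) (hK : IsImaginaryQuadratic K)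
  (hne3 : NumberField.discr K ≠ -3) (hne4 : NumberField.discr K ≠ -4)
  (h2d : ¬ ((2 : ℤ) ∣ NumberField.discr K)) (hHN : SatisfiesHeegnerHypothesis (W.conductorNorm ℤ) K)
  (hτ1 : τ ≠ 1)
  -- the uniform inflation defect `k` of the `2`-adic division tower (off habitat: `inflationDefect_of_serre`)
  {k : ℕ}
  (hSah : ∀ (M M' : ℕ), M ≤ M' → ∀ x : galH1Torsion (W.baseChange K) ((2 ^ M : ℕ) : ℤ),
    (∀ g ∈ torsionFixing (W.baseChange K) ((2 ^ M' : ℕ) : ℤ),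
      h1Eval (W.baseChange K) ((2 ^ M : ℕ) : ℤ) x g = 0) → (2 : ℤ) ^ k • x = 0)
  (hperf : ∀ M, (inv M).IsPerfect) (hvan : ∀ M, (inv M).SumLocalTermEqZero)
  -- P8: the transverse package at `2`
  (h𝒯sd : ∀ (M c : ℕ), ∀ v ∈ placesDividing K c,
    (inv M).dualTransported (𝒯 M) (weilDualIntertwining (W.baseChange K) (2 ^ M) (e M) (hμ M) (hadd₁ M)
      (hadd₂ M) (hgal M)) (Sum.inr v) = 𝒯 M (Sum.inr v))
  -- P4: transversality at the primes of the conductor (margin one)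
  (hP4 : ∀ (M c : ℕ) (dat : KolyvaginHeegnerData Dt β ι c),
    KolyvaginDescent.KolSupp (Zhang2014.IsKolyvaginPrime (W.conductorNorm ℤ) W K 2) c → 1 ≤ M →
    (∀ q ∈ c.primeFactors, M + 1 ≤ Zhang2014.kolyvaginIndex W 2 q) →
    ∀ w ∈ placesDividing K c,
      galoisCohomology.localization ((W.baseChange K).torsionGaloisModule ((2 ^ M : ℕ) : ℤ)) (Sum.inr w) 1
        (dat.kolyvaginClass Nat.prime_two M) ∈ 𝒯 M (Sum.inr w))
  -- P5: auxiliary classes of order ≥ 2^(M/2 - 5)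
  (hP5 : ∀ (M m a : ℕ) (v₀ : HeightOneSpectrum (𝓞 K)) (s : ℤ), (s = 1 ∨ s = -1) → 9 ≤ M →
    KolyvaginDescent.KolSupp (Zhang2014.IsKolyvaginPrime (W.conductorNorm ℤ) W K 2) m →
    (∀ q ∈ m.primeFactors, M + 1 ≤ Zhang2014.kolyvaginIndex W 2 q) →
    Zhang2014.IsKolyvaginPrime (W.conductorNorm ℤ) W K 2 a → M + 1 ≤ Zhang2014.kolyvaginIndex W 2 a →
    ¬ a ∣ m → ((a : ℕ) : 𝓞 K) ∈ v₀.asIdeal →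
    ∃ w : galoisCohomology ((W.baseChange K).torsionGaloisModule ((2 ^ M : ℕ) : ℤ)) 1,
      w ∈ signPart W K τ ((2 ^ M : ℕ) : ℤ) s
        (((selmerF W ((2 ^ M : ℕ) : ℤ) (𝒯 M) (placesDividing K m)).relaxedAt {v₀}).selmerGroup) ∧
      ((2 ^ (M / 2 - 5) : ℕ) : ℤ) • w ≠ 0)
  -- P7a: lower bound of the pairing order at a fresh Kolyvagin prime
  (hP7a : ∀ (M M' ℓ : ℕ) (v : HeightOneSpectrum (𝓞 K))
    (w C : galoisCohomology ((W.baseChange K).torsionGaloisModule ((2 ^ M : ℕ) : ℤ)) 1) (s : ℤ) (a b : ℕ),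
    (s = 1 ∨ s = -1) → Zhang2014.IsKolyvaginPrime (W.conductorNorm ℤ) W K 2 ℓ →
    M ≤ Zhang2014.kolyvaginIndex W 2 ℓ → M ≤ M' → FrobEqFrobInfty W K (2 ^ M') ℓ →
    ((ℓ : ℕ) : 𝓞 K) ∈ v.asIdeal →
    conjAct W τ ((2 ^ M : ℕ) : ℤ) w = s • w → conjAct W τ ((2 ^ M : ℕ) : ℤ) C = s • C →
    galoisCohomology.localization ((W.baseChange K).torsionGaloisModule ((2 ^ M : ℕ) : ℤ)) (Sum.inr v) 1 w ∈
      (W.baseChange K).kummerSelmerStructure ((2 ^ M : ℕ) : ℤ) (Sum.inr v) →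
    ((2 ^ a : ℕ) : ℤ) • galoisCohomology.localization ((W.baseChange K).torsionGaloisModule ((2 ^ M : ℕ) : ℤ))
      (Sum.inr v) 1 w ≠ 0 →
    ((2 ^ b : ℕ) : ℤ) • galoisCohomology.localization ((W.baseChange K).torsionGaloisModule ((2 ^ M : ℕ) : ℤ))
      (Sum.inr v) 1 C ∉ (W.baseChange K).kummerSelmerStructure ((2 ^ M : ℕ) : ℤ) (Sum.inr v) →
    M + 2 ≤ a + b + 1 →
    (2 ^ (a + b + 1 - M - 2) : ℕ) •
        localTatePairingZMod ((W.baseChange K).torsionGaloisModule ((2 ^ M : ℕ) : ℤ)) (2 ^ M) (Sum.inr v)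
          (inv M (Sum.inr v))
          (galoisCohomology.localization ((W.baseChange K).torsionGaloisModule ((2 ^ M : ℕ) : ℤ)) (Sum.inr v) 1 w)
          (galoisCohomology.localization (((W.baseChange K).torsionGaloisModule ((2 ^ M : ℕ) : ℤ)).tateDual (2 ^ M))
            (Sum.inr v) 1
            (galoisCohomology.map (weilDualIntertwining (W.baseChange K) (2 ^ M) (e M) (hμ M) (hadd₁ M) (hadd₂ M)
              (hgal M)) 1 C)) ≠ 0)
  -- P7b: upper bound of the pairing order at the prime being swapped out
  (hP7b : ∀ (M q : ℕ) (v : HeightOneSpectrum (𝓞 K))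
    (w C : galoisCohomology ((W.baseChange K).torsionGaloisModule ((2 ^ M : ℕ) : ℤ)) 1) (s : ℤ) (a₀ b₀ : ℕ),
    (s = 1 ∨ s = -1) → Zhang2014.IsKolyvaginPrime (W.conductorNorm ℤ) W K 2 q →
    M + 1 ≤ Zhang2014.kolyvaginIndex W 2 q → ((q : ℕ) : 𝓞 K) ∈ v.asIdeal →
    conjAct W τ ((2 ^ M : ℕ) : ℤ) w = s • w → conjAct W τ ((2 ^ M : ℕ) : ℤ) C = s • C →
    galoisCohomology.localization ((W.baseChange K).torsionGaloisModule ((2 ^ M : ℕ) : ℤ)) (Sum.inr v) 1 C ∈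
      𝒯 M (Sum.inr v) →
    ((2 ^ a₀ : ℕ) : ℤ) • galoisCohomology.localization ((W.baseChange K).torsionGaloisModule ((2 ^ M : ℕ) : ℤ))
      (Sum.inr v) 1 w ∈ 𝒯 M (Sum.inr v) →
    ((2 ^ b₀ : ℕ) : ℤ) • galoisCohomology.localization ((W.baseChange K).torsionGaloisModule ((2 ^ M : ℕ) : ℤ))
      (Sum.inr v) 1 C = 0 →
    (2 ^ (a₀ + b₀ + 0 - M) : ℕ) •
        localTatePairingZMod ((W.baseChange K).torsionGaloisModule ((2 ^ M : ℕ) : ℤ)) (2 ^ M) (Sum.inr v)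
          (inv M (Sum.inr v))
          (galoisCohomology.localization ((W.baseChange K).torsionGaloisModule ((2 ^ M : ℕ) : ℤ)) (Sum.inr v) 1 w)
          (galoisCohomology.localization (((W.baseChange K).torsionGaloisModule ((2 ^ M : ℕ) : ℤ)).tateDual (2 ^ M))
            (Sum.inr v) 1
            (galoisCohomology.map (weilDualIntertwining (W.baseChange K) (2 ^ M) (e M) (hμ M) (hadd₁ M) (hadd₂ M)
              (hgal M)) 1 C)) = 0)
  -- Q2's print input (Gross 1991 Prop. 3.7 (2), image-free; the off-habitat Q2 is p650518)
  (h37 : prop37_2_frobeniusCongruence)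
  -- T2 (landed, p612348) and S2 (landed, krr2-p2) — their bodies for this frame
  {t : ℕ}
  (hT2 : ∀ (n : ℕ) (d : KolyvaginHeegnerData Dt β ι n) (M : ℕ),
    KolyvaginDescent.KolSupp (Zhang2014.IsKolyvaginPrime (W.conductorNorm ℤ) W K 2) n →
    1 ≤ M → (M : ℕ∞) ≤ Zhang2014.levelIndex W 2 n →
    ∀ v : HeightOneSpectrum (𝓞 K), ((n : ℕ) : 𝓞 K) ∉ v.asIdeal →
      ((2 ^ t : ℕ) : ℤ) • d.kolyvaginClass Nat.prime_two M ∈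
        selmerLocalKer (W.baseChange K) (v.adicCompletion K) ((2 ^ M : ℕ) : ℤ))
  {c₁ : ℕ}
  (hS2 : ∀ (n : ℕ) (dat : KolyvaginHeegnerData Dt β ι n) (M m I : ℕ),
    KolyvaginDescent.KolSupp (Zhang2014.IsKolyvaginPrime (W.conductorNorm ℤ) W K 2) n → 1 ≤ M →
    (M : ℕ∞) ≤ Zhang2014.levelIndex W 2 n → M ≤ I → c₁ ≤ m →
    ((2 ^ m : ℕ) : ℤ) • dat.kolyvaginClass Nat.prime_two M ≠ 0 →
    ∀ X' : Finset ℕ, ∃ q : ℕ, q ∉ X' ∧ Zhang2014.IsKolyvaginPrime (W.conductorNorm ℤ) W K 2 q ∧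
      I ≤ Zhang2014.kolyvaginIndex W 2 q ∧ ∃ v : HeightOneSpectrum (𝓞 K), ((q : ℕ) : 𝓞 K) ∈ v.asIdeal ∧
        ((2 ^ (m - c₁) : ℕ) : ℤ) • dat.kolyvaginClass Nat.prime_two M ∉
          (W.baseChange K).torsionLocalKer (v.adicCompletion K) ((2 ^ M : ℕ) : ℤ))

/-! ### The swap, conductor currency `n ↦ n / a · ℓ` -/

include halt hnondeg hCM hred htorQ hK hne3 hne4 h2d hHN hτ1 hSah hperf hvan h𝒯sd hP4 hP5 hP7a hP7b h37 hT2 hS2 in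
/-- **The prime swap at `2`, core, OFF THE HABITAT** (conductor currency; Frobenius-threaded P7a; P5 only for
`M ≥ 9`; twin of `primeSwapAtTwoLossy_core_frob_nine` with `E(ℚ)[2] = 0` + inflation defect `k` in place of the
surjective `2`-adic tower): from a square-free product `n` of Kolyvagin primes of index `≥ M + 1`, a prime `a ∣ n`,
a datum of conductor `n` whose class `c_M(n)` is BIG at exponent `j` with `M + c₀ ≤ 2 j`, produce a fresh Kolyvagin
prime `ℓ ∉ X`, `ℓ ∤ n`, of index `≥ I` with `Frob_ℓ = Frob_∞` in `Gal(K(E[2^I])/ℚ)`, seeing `c_M(n)` at exponent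
`j − c₂`, and a datum of conductor `n / a · ℓ` BIG at exponent `j − c₂`. Proof = the habitat S1-PLAN verbatim: `w` (P5) of
exact order `2^u`, pair Čebotarev off habitat (`ℓ`, `v'`, defect `k + 1`), data triple (P1),
`C' = 2^t c_M(nℓ) ∈ H¹_{𝓕(nℓ)}`, two-term reciprocity (P6) + pairing orders (P7a at `v'`, P7b at `v₀ ∣ a`) ⇒
`2^{j-2k-4} c_M(nℓ) ∉ ker loc_{v₀}`, Q2 off habitat at `a` ⇒ the same for `c_M(nℓ/a)`, S2 ⇒ BIG.
[cite: Kolyvagin1991MathAnn, §2 Thm. 2.2, p. 257] [cite: McCallumLMS1991, §5 Prop. 5.2] [cite: WZhang2014, Lemma 8.4] -/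
theorem primeSwapAtTwoLossy_core_offHabitat {M I j n a : ℕ} (X : Finset ℕ) (dat : KolyvaginHeegnerData Dt β ι n)
    (hM : 1 ≤ M) (hMI : M + 1 ≤ I) (hn : Squarefree n)
    (hnK : ∀ p ∈ n.primeFactors, Zhang2014.IsKolyvaginPrime (W.conductorNorm ℤ) W K 2 p ∧
      M + 1 ≤ Zhang2014.kolyvaginIndex W 2 p)
    (ha : a ∈ n.primeFactors) (hj : M + 2 * (c₁ + 2 * k + t + 12) ≤ 2 * j)
    (hBig : ∀ X' : Finset ℕ, ∃ q : ℕ, q ∉ X' ∧ Zhang2014.IsKolyvaginPrime (W.conductorNorm ℤ) W K 2 q ∧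
      I ≤ Zhang2014.kolyvaginIndex W 2 q ∧
      ∃ v : HeightOneSpectrum (𝓞 K), ((q : ℕ) : 𝓞 K) ∈ v.asIdeal ∧
        ((2 ^ j : ℕ) : ℤ) • dat.kolyvaginClass Nat.prime_two M ∉
          (W.baseChange K).torsionLocalKer (v.adicCompletion K) ((2 ^ M : ℕ) : ℤ)) :
    ∃ ℓ : ℕ, ℓ ∉ X ∧ ℓ ∉ n.primeFactors ∧ Zhang2014.IsKolyvaginPrime (W.conductorNorm ℤ) W K 2 ℓ ∧
      I ≤ Zhang2014.kolyvaginIndex W 2 ℓ ∧ FrobEqFrobInfty W K (2 ^ I) ℓ ∧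
      (∃ v : HeightOneSpectrum (𝓞 K), ((ℓ : ℕ) : 𝓞 K) ∈ v.asIdeal ∧
        ((2 ^ (j - (c₁ + 2 * k + 4)) : ℕ) : ℤ) • dat.kolyvaginClass Nat.prime_two M ∉
          (W.baseChange K).torsionLocalKer (v.adicCompletion K) ((2 ^ M : ℕ) : ℤ)) ∧
      ∃ dat' : KolyvaginHeegnerData Dt β ι (n / a * ℓ),
        ∀ X' : Finset ℕ, ∃ q : ℕ, q ∉ X' ∧
          Zhang2014.IsKolyvaginPrime (W.conductorNorm ℤ) W K 2 q ∧
          I ≤ Zhang2014.kolyvaginIndex W 2 q ∧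
          ∃ v : HeightOneSpectrum (𝓞 K), ((q : ℕ) : 𝓞 K) ∈ v.asIdeal ∧
            ((2 ^ (j - (c₁ + 2 * k + 4)) : ℕ) : ℤ) • dat'.kolyvaginClass Nat.prime_two M ∉
              (W.baseChange K).torsionLocalKer (v.adicCompletion K) ((2 ^ M : ℕ) : ℤ) := by
  classical
  -- (0) numerics of `n`, `a`, `m := n / a`
  have hn0 : n ≠ 0 := hn.ne_zero
  have hap : a.Prime := Nat.prime_of_mem_primeFactors ha
  have han : a ∣ n := Nat.dvd_of_mem_primeFactors ha
  have hKola : Zhang2014.IsKolyvaginPrime (W.conductorNorm ℤ) W K 2 a := (hnK a ha).1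
  have hidxa : M + 1 ≤ Zhang2014.kolyvaginIndex W 2 a := (hnK a ha).2
  have hnKol : KolyvaginDescent.KolSupp (Zhang2014.IsKolyvaginPrime (W.conductorNorm ℤ) W K 2) n :=
    ⟨hn, fun q hq ↦ (hnK q hq).1⟩
  have hnlev : (M : ℕ∞) ≤ Zhang2014.levelIndex W 2 n :=
    Zhang2014.natCast_le_levelIndex_iff.mpr fun q hq ↦ Nat.le_of_succ_le (hnK q hq).2
  have hmn : n / a ∣ n := Nat.div_dvd_of_dvd han
  have hm : Squarefree (n / a) := hn.squarefree_of_dvd hmn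
  have hm0 : n / a ≠ 0 := hm.ne_zero
  have hmpf : ∀ q ∈ (n / a).primeFactors, q ∈ n.primeFactors :=
    fun q hq ↦ Nat.primeFactors_mono hmn hn0 hq
  have ham : a ∉ (n / a).primeFactors := by
    intro h
    have hdvd₂ : a * a ∣ n := by
      have := Nat.mul_dvd_mul_left a (Nat.dvd_of_mem_primeFactors h)
      rwa [Nat.mul_div_cancel' han] at this
    exact hap.one_lt.ne' (Nat.isUnit_iff.mp (hn a hdvd₂))
  have hadvm : ¬ a ∣ n / a := fun h ↦ ham (Nat.mem_primeFactors.mpr ⟨hap, h, hm0⟩)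
  have hmKol : KolyvaginDescent.KolSupp (Zhang2014.IsKolyvaginPrime (W.conductorNorm ℤ) W K 2) (n / a) :=
    ⟨hm, fun q hq ↦ (hnK q (hmpf q hq)).1⟩
  have hmidx : ∀ q ∈ (n / a).primeFactors, M + 1 ≤ Zhang2014.kolyvaginIndex W 2 q :=
    fun q hq ↦ (hnK q (hmpf q hq)).2
  -- (1) the place `v₀ ∣ a` (`a` is inert)
  obtain ⟨v₀, hv₀⟩ : ∃ v : HeightOneSpectrum (𝓞 K), ((a : ℕ) : 𝓞 K) ∈ v.asIdeal :=
    ⟨⟨Ideal.span {((a : ℕ) : 𝓞 K)}, hKola.2.2.2.2.1, by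
        rw [Ne, Ideal.span_singleton_eq_bot]; exact_mod_cast hap.ne_zero⟩,
      Ideal.mem_span_singleton_self _⟩
  -- (2) `2^j c ≠ 0`, hence `j < M`
  obtain ⟨-, -, -, -, v₁, -, hv₁⟩ := hBig ∅
  have hjc : ((2 ^ j : ℕ) : ℤ) • dat.kolyvaginClass Nat.prime_two M ≠ 0 := by
    intro h; exact hv₁ (by rw [h]; exact zero_mem _)
  have hMc : ((2 ^ M : ℕ) : ℤ) • dat.kolyvaginClass Nat.prime_two M = 0 := zsmul_galH1Torsion_eq_zero _ _ _
  have hjM : j < M := by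
    by_contra h
    exact hjc (two_pow_zsmul_eq_zero_of_le_swap (not_lt.mp h) hMc)
  -- (3) the signs of complex conjugation at depths `ν(n)` and `ν(n) + 1` (T3)
  obtain ⟨εn, hεn, hsignn⟩ := conjSign_offHabitat W hCM hred htorQ K hK hne3 hne4 h2d hHN Dt β ι τ hτ1
    n.primeFactors.card
  obtain ⟨ε', hε', hsign'⟩ := conjSign_offHabitat W hCM hred htorQ K hK hne3 hne4 h2d hHN Dt β ι τ hτ1
    (n.primeFactors.card + 1)
  have hcsign : conjAct W τ ((2 ^ M : ℕ) : ℤ) (dat.kolyvaginClass Nat.prime_two M) =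
      εn • dat.kolyvaginClass Nat.prime_two M := hsignn n dat M hnKol rfl hM hnlev
  -- (4) the auxiliary class `w` (P5) and its exact order `2^u`
  obtain ⟨w, hwsign, hword⟩ := hP5 M (n / a) a v₀ ε' hε' (by omega) hmKol hmidx hKola hidxa hadvm hv₀
  obtain ⟨hwF, hwτ⟩ := (mem_signPart_iff W K τ _ _ _ w).mp hwsign
  have hMw : ((2 ^ M : ℕ) : ℤ) • w = 0 := zsmul_galH1Torsion_eq_zero (W.baseChange K) _ w
  obtain ⟨u, hru, huM, hu0, hu1⟩ := exists_two_pow_orderExp_swap w hMw hword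
  -- (5) pair Čebotarev: the fresh prime `ℓ` and its place `v'`
  have hw0 : w ≠ 0 := fun h ↦ hword (by rw [h, zsmul_zero])
  have hc0 : dat.kolyvaginClass Nat.prime_two M ≠ 0 := fun h ↦ hjc (by rw [h, zsmul_zero])
  obtain ⟨ℓ, hℓS, hKolℓ, hIℓ, hfrob, v', hv', hwloc, hcloc⟩ :=
    exists_kolyvaginPrime_notMem_pair_orderFree_of_inflationDefect hK (simple_two_of_torsionBy_eq_bot W htorQ K hK)
      hτ1 hM (Nat.le_of_succ_le hMI) (hSah M I (Nat.le_of_succ_le hMI))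
      w (dat.kolyvaginClass Nat.prime_two M) hw0 hc0 hε' hεn hwτ hcsign (X ∪ n.primeFactors)
  rw [Finset.mem_union, not_or] at hℓS
  obtain ⟨hℓX, hℓn⟩ := hℓS
  have hℓp : ℓ.Prime := hKolℓ.1
  have hℓ0 : ℓ ≠ 0 := hℓp.ne_zero
  have hℓdvd : ¬ ℓ ∣ n := fun h ↦ hℓn (Nat.mem_primeFactors.mpr ⟨hℓp, h, hn0⟩)
  have hMℓ : M ≤ Zhang2014.kolyvaginIndex W 2 ℓ := le_trans (by omega) hIℓ
  have hM1ℓ : M + 1 ≤ Zhang2014.kolyvaginIndex W 2 ℓ := le_trans hMI hIℓ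
  -- numerics of `n ℓ` and `n / a · ℓ`
  have hN : Squarefree (n * ℓ) :=
    (Nat.squarefree_mul ((Nat.Prime.coprime_iff_not_dvd hℓp).mpr hℓdvd).symm).mpr ⟨hn, hℓp.squarefree⟩
  have hN0 : n * ℓ ≠ 0 := hN.ne_zero
  have hNpf : (n * ℓ).primeFactors = n.primeFactors ∪ {ℓ} := by
    rw [Nat.primeFactors_mul hn0 hℓ0, hℓp.primeFactors]
  have hNK : ∀ q ∈ (n * ℓ).primeFactors, Zhang2014.IsKolyvaginPrime (W.conductorNorm ℤ) W K 2 q ∧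
      M + 1 ≤ Zhang2014.kolyvaginIndex W 2 q := by
    intro q hq
    rw [hNpf, Finset.mem_union, Finset.mem_singleton] at hq
    rcases hq with hq | rfl
    · exact hnK q hq
    · exact ⟨hKolℓ, hM1ℓ⟩
  have hNK' : ∀ q ∈ (n * ℓ).primeFactors, Zhang2014.IsKolyvaginPrime (W.conductorNorm ℤ) W K 2 q ∧
      M ≤ Zhang2014.kolyvaginIndex W 2 q :=
    fun q hq ↦ ⟨(hNK q hq).1, Nat.le_of_succ_le (hNK q hq).2⟩
  have hNKol : KolyvaginDescent.KolSupp (Zhang2014.IsKolyvaginPrime (W.conductorNorm ℤ) W K 2) (n * ℓ) :=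
    ⟨hN, fun q hq ↦ (hNK q hq).1⟩
  have hNcard : (n * ℓ).primeFactors.card = n.primeFactors.card + 1 := by
    rw [hNpf, Finset.card_union_of_disjoint (Finset.disjoint_singleton_right.mpr hℓn),
      Finset.card_singleton]
  have hNlev : (M : ℕ∞) ≤ Zhang2014.levelIndex W 2 (n * ℓ) :=
    Zhang2014.natCast_le_levelIndex_iff.mpr fun q hq ↦ (hNK' q hq).2
  have hn''eq : n / a * ℓ * a = n * ℓ := by rw [mul_right_comm, Nat.div_mul_cancel han]
  have ha'' : ¬ a ∣ n / a * ℓ := by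
    intro h
    have : a * a ∣ n / a * ℓ * a := by
      rw [mul_comm (n / a * ℓ) a]; exact Nat.mul_dvd_mul_left a h
    rw [hn''eq] at this
    exact hap.one_lt.ne' (Nat.isUnit_iff.mp (hN a this))
  have hn''dvd : n / a * ℓ ∣ n * ℓ := Dvd.intro a hn''eq
  have hn''sq : Squarefree (n / a * ℓ) := hN.squarefree_of_dvd hn''dvd
  have hn''K : ∀ q ∈ (n / a * ℓ).primeFactors, Zhang2014.IsKolyvaginPrime (W.conductorNorm ℤ) W K 2 q ∧
      M + 1 ≤ Zhang2014.kolyvaginIndex W 2 q :=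
    fun q hq ↦ hNK q (Nat.primeFactors_mono hn''dvd hN0 hq)
  have hn''Kol : KolyvaginDescent.KolSupp (Zhang2014.IsKolyvaginPrime (W.conductorNorm ℤ) W K 2) (n / a * ℓ) :=
    ⟨hn''sq, fun q hq ↦ (hn''K q hq).1⟩
  have hn''lev : (M : ℕ∞) ≤ Zhang2014.levelIndex W 2 (n / a * ℓ) :=
    Zhang2014.natCast_le_levelIndex_iff.mpr fun q hq ↦ Nat.le_of_succ_le (hn''K q hq).2
  -- (6) the data triple (P1)
  have hD : NumberField.discr K < -4 :=
    hK.discr_lt_neg_four_of_odd (Int.not_even_iff_odd.mp fun h ↦ h2d (even_iff_two_dvd.mp h)) hne3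
  obtain ⟨d', d'', hσ, hS, hS', hemb, hσ₁, hS₁, hS₁', hemb₁⟩ :=
    Summit.BirchSwinnertonDyer.Rank1Residual.JET.exists_compatible_data_triple_of_grossCM (W := W) hK hD
      hHN 2 Dt β ι hn (fun q hq ↦ (hnK q hq).1) ha hKolℓ hℓn dat
  -- (7) the class `C' := 2^t · c_M(nℓ)`: sign and Selmer membership
  have hCsign : conjAct W τ ((2 ^ M : ℕ) : ℤ) (d'.kolyvaginClass Nat.prime_two M) =
      ε' • d'.kolyvaginClass Nat.prime_two M := hsign' (n * ℓ) d' M hNKol hNcard hM hNlev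
  have hC'sign : conjAct W τ ((2 ^ M : ℕ) : ℤ) (((2 ^ t : ℕ) : ℤ) • d'.kolyvaginClass Nat.prime_two M) =
      ε' • (((2 ^ t : ℕ) : ℤ) • d'.kolyvaginClass Nat.prime_two M) := by
    rw [map_zsmul, hCsign, smul_comm]
  have hC'F := zsmul_kolyvaginClass_mem_selmerF W Dt β ι 𝒯 (hK := hK) (hP4 := hP4) (hT2 := hT2) d' hNKol hM
    (fun q hq ↦ (hNK q hq).2)
  -- (8) places
  obtain ⟨hv'v₀, hv₀m, hv'm, hv₀N, hv'N, hmc, hcov⟩ :=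
    swapPlaces (K := K) hn ha hKola.2.2.2.2.1 hℓp hKolℓ.2.2.2.2.1 hℓn hv₀ hv'
  -- (9) local facts at `v'` (inputs of P7a): `w` is Kummer there, of local order `≥ 2^(u-2)`;
  --     `2^(j-2) c_M(nℓ)` is not Kummer there (pair Čebotarev + Q2 at `ℓ`)
  have hwKum : galoisCohomology.localization ((W.baseChange K).torsionGaloisModule ((2 ^ M : ℕ) : ℤ)) (Sum.inr v') 1 w ∈ (W.baseChange K).kummerSelmerStructure ((2 ^ M : ℕ) : ℤ) (Sum.inr v') := by
    have h := (SelmerStructure.mem_selmerGroup_iff _ w).mp hwF (Sum.inr v')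
    rwa [relaxedAt_inr_of_ne W _ _ hv'v₀, selmerF_inr, if_neg hv'm] at h
  have hwa : ((2 ^ (u - (k + 2)) : ℕ) : ℤ) • galoisCohomology.localization ((W.baseChange K).torsionGaloisModule ((2 ^ M : ℕ) : ℤ)) (Sum.inr v') 1 w ≠ 0 := by
    intro h0
    refine hwloc (u - (k + 2)) (by rw [show u - (k + 2) + (k + 1) = u - 1 by omega]; exact hu1)
      ((mem_torsionLocalKer_two_pow_iff W M v' _).mpr
        ((map_zsmul (galoisCohomology.localization ((W.baseChange K).torsionGaloisModule ((2 ^ M : ℕ) : ℤ)) (Sum.inr v') 1) _ _).trans h0))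
  have hcj2 : ((2 ^ (j - (k + 1)) : ℕ) : ℤ) • dat.kolyvaginClass Nat.prime_two M ∉
      (W.baseChange K).torsionLocalKer (v'.adicCompletion K) ((2 ^ M : ℕ) : ℤ) :=
    hcloc (j - (k + 1)) (by rw [show j - (k + 1) + (k + 1) = j by omega]; exact hjc)
  have hQℓ := GenusExact.kolyvaginRelationAtTwo_offHabitat_of_frobeniusCongruence h37 W hCM K hK hne3 hne4 hHN
    htorQ Dt β ι M hM n ℓ hN hℓp hℓdvd hNK' dat d' hσ hS hS' hemb v' hv'
  have hCb : ((2 ^ (j - (k + 1) - t) : ℕ) : ℤ) • galoisCohomology.localization ((W.baseChange K).torsionGaloisModule ((2 ^ M : ℕ) : ℤ)) (Sum.inr v') 1 (((2 ^ t : ℕ) : ℤ) • d'.kolyvaginClass Nat.prime_two M) ∉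
      (W.baseChange K).kummerSelmerStructure ((2 ^ M : ℕ) : ℤ) (Sum.inr v') := by
    intro h
    have h1 : ((2 ^ (j - (k + 1)) : ℕ) : ℤ) • d'.kolyvaginClass Nat.prime_two M ∈
        selmerLocalKer (W.baseChange K) (v'.adicCompletion K) ((2 ^ M : ℕ) : ℤ) := by
      refine (mem_selmerLocalKer_two_pow_iff W M v' _).mpr ?_
      have h2 : ((2 ^ (j - (k + 1)) : ℕ) : ℤ) • d'.kolyvaginClass Nat.prime_two M =
          ((2 ^ (j - (k + 1) - t) : ℕ) : ℤ) • (((2 ^ t : ℕ) : ℤ) • d'.kolyvaginClass Nat.prime_two M) := by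
        rw [smul_smul, ← Nat.cast_mul, ← pow_add, show j - (k + 1) - t + t = j - (k + 1) by omega]
      rw [h2]
      exact mem_of_eq_of_mem_swap h (map_zsmul (galoisCohomology.localization ((W.baseChange K).torsionGaloisModule ((2 ^ M : ℕ) : ℤ)) (Sum.inr v') 1) _ _)
    exact hcj2 ((hQℓ (j - (k + 1))).2.mp ((hQℓ (j - (k + 1))).1.mp h1))
  -- (10) local facts at `v₀` (inputs of P7b)
  have hC'T : galoisCohomology.localization ((W.baseChange K).torsionGaloisModule ((2 ^ M : ℕ) : ℤ)) (Sum.inr v₀) 1 (((2 ^ t : ℕ) : ℤ) • d'.kolyvaginClass Nat.prime_two M) ∈ 𝒯 M (Sum.inr v₀) :=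
    ((mem_selmerGroup_selmerF_iff W _ (𝒯 M) hN0 _).mp hC'F).2 v₀ hv₀N
  have hwu : ((2 ^ u : ℕ) : ℤ) • galoisCohomology.localization ((W.baseChange K).torsionGaloisModule ((2 ^ M : ℕ) : ℤ)) (Sum.inr v₀) 1 w ∈ 𝒯 M (Sum.inr v₀) := by
    have : ((2 ^ u : ℕ) : ℤ) • galoisCohomology.localization ((W.baseChange K).torsionGaloisModule ((2 ^ M : ℕ) : ℤ)) (Sum.inr v₀) 1 w = 0 := by
      rw [← map_zsmul, hu0, map_zero]
    rw [this]; exact zero_mem _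
  -- (11) THE KEY STEP: `2^(j-4-2-0) c_M(nℓ) ∉ ker loc_{v₀}` (P6 + P7a + P7b)
  have hkey : ((2 ^ (j - 2 * k - 4) : ℕ) : ℤ) • d'.kolyvaginClass Nat.prime_two M ∉
      (W.baseChange K).torsionLocalKer (v₀.adicCompletion K) ((2 ^ M : ℕ) : ℤ) := by
    intro hker
    have hb₀ : ((2 ^ (j - t - 2 * k - 4) : ℕ) : ℤ) •
        galoisCohomology.localization ((W.baseChange K).torsionGaloisModule ((2 ^ M : ℕ) : ℤ)) (Sum.inr v₀) 1 (((2 ^ t : ℕ) : ℤ) • d'.kolyvaginClass Nat.prime_two M) = 0 := by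
      have h2 : ((2 ^ (j - t - 2 * k - 4) : ℕ) : ℤ) • (((2 ^ t : ℕ) : ℤ) • d'.kolyvaginClass Nat.prime_two M) =
          ((2 ^ (j - 2 * k - 4) : ℕ) : ℤ) • d'.kolyvaginClass Nat.prime_two M := by
        rw [smul_smul, ← Nat.cast_mul, ← pow_add,
          show j - t - 2 * k - 4 + t = j - 2 * k - 4 by omega]
      have h1 := (mem_torsionLocalKer_two_pow_iff W M v₀ _).mp hker
      rw [← h2] at h1
      exact (map_zsmul (galoisCohomology.localization ((W.baseChange K).torsionGaloisModule ((2 ^ M : ℕ) : ℤ)) (Sum.inr v₀) 1) _ _).symm.trans h1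
    have hB := hP7b M a v₀ w (((2 ^ t : ℕ) : ℤ) • d'.kolyvaginClass Nat.prime_two M) ε' u
      (j - t - 2 * k - 4) hε' hKola hidxa hv₀ hwτ hC'sign hC'T hwu hb₀
    have hA := hP7a M I ℓ v' w (((2 ^ t : ℕ) : ℤ) • d'.kolyvaginClass Nat.prime_two M) ε' (u - (k + 2))
      (j - (k + 1) - t) hε' hKolℓ hMℓ (Nat.le_of_succ_le hMI) hfrob hv' hwτ hC'sign hwKum hwa hCb (by omega)
    have hsum := localTatePairing_add_eq_zero_of_swap W 2 M (e M) (hμ M) (hadd₁ M) (hadd₂ M) (hgal M)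
      (halt M) (hnondeg M) hK hM (inv M) (fun v ↦ ((hperf M) v).1.injective) (hvan M) (𝒯 M)
      (h𝒯sd M (n * ℓ)) hv'v₀.symm hcov hmc hv₀m hv₀N hv'N w
      (((2 ^ t : ℕ) : ℤ) • d'.kolyvaginClass Nat.prime_two M) hwF hC'F
    have hexp : u - (k + 2) + (j - (k + 1) - t) + 1 - M - 2 = u + (j - t - 2 * k - 4) + 0 - M := by omega
    rw [hexp] at hA
    have h3 := congrArg (fun x : ZMod (2 ^ M) ↦ (2 ^ (u + (j - t - 2 * k - 4) + 0 - M) : ℕ) • x) hsum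
    simp only [smul_add, smul_zero] at h3
    rw [hB, zero_add] at h3
    exact hA h3
  -- (12) Q2 at `a`: the same for `c_M(nℓ/a)`; hence non-zero
  have hQa := kolyvaginRelationAtTwo_cast_offHabitat h37 W hCM htorQ hK hne3 hne4 hHN Dt β ι M hM hn''eq hN hap
    ha'' hNK' d'' d' hσ₁ hS₁ hS₁' hemb₁ v₀ hv₀ (j - 2 * k - 4)
  have hkey'' : ((2 ^ (j - 2 * k - 4) : ℕ) : ℤ) • d''.kolyvaginClass Nat.prime_two M ∉
      (W.baseChange K).torsionLocalKer (v₀.adicCompletion K) ((2 ^ M : ℕ) : ℤ) := fun h ↦ hkey (hQa.2.mpr h)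
  have hne'' : ((2 ^ (j - 2 * k - 4) : ℕ) : ℤ) • d''.kolyvaginClass Nat.prime_two M ≠ 0 :=
    fun h ↦ hkey'' (by rw [h]; exact zero_mem _)
  -- (13) S2: `c_M(nℓ/a)` is BIG at exponent `j - c₂`
  have hBig'' := hS2 (n / a * ℓ) d'' M (j - 2 * k - 4) I hn''Kol hM hn''lev (by omega) (by omega) hne''
  -- (14) assemble
  refine ⟨ℓ, hℓX, hℓn, hKolℓ, hIℓ, hfrob, ⟨v', hv', hcloc _ (two_pow_zsmul_ne_zero_of_le_swap (by omega) hjc)⟩,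
    d'', fun X' ↦ ?_⟩
  obtain ⟨q, hqX, hKq, hIq, v, hv, hloc⟩ := hBig'' X'
  refine ⟨q, hqX, hKq, hIq, v, hv, ?_⟩
  rwa [show j - 2 * k - 4 - c₁ = j - (c₁ + 2 * k + 4) by omega] at hloc

end Frame

end Summit.BirchSwinnertonDyer.BirchSwinnertonDyer.Theorems.KolyvaginLowerBoundAtTwo

end
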